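import Mathlib.RingTheory.Derivation.Basic
import Mathlib.Algebra.MvPolynomial.PDeriv
import Mathlib.RingTheory.Localization.FractionRing
import Mathlib.RingTheory.Polynomial.UniqueFactorization
import Mathlib.FieldTheory.IsAlgClosed.Basic
import Mathlib.FieldTheory.IntermediateField.Adjoin.Basic
import Mathlib.FieldTheory.Perfect
import Mathlib.FieldTheory.Minpoly.Field
import Mathlib.Algebra.CharP.Algebra
import Literature.RingTheory.Localization.DerivationFractionField
import Literature.AlgebraicGeometry.Resolution.AlterationsNodalMonomialization
import Literature.FieldTheory.TranscendenceDegree.AlgebraicDependenceBookkeeping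
import Literature.RingTheory.MvPolynomial.RuppertReducibleProofs
import HarnessLib

/-!
# Gao–Ruppert: residues of closed logarithmic forms along an irreducible plane curve are constant

Support file for the characteristic-zero half of the **Gao–Ruppert kernel theorem**
(`RuppertGaoKernel.lean`): for a squarefree `φ = φ₁ ⋯ φ_r ∈ F[X, Y]` over an algebraically
closed field of characteristic zero, the kernel of Ruppert's linear map
`R_φ(G, H) = φ G_Y − G φ_Y − φ H_X + H φ_X` (tree file `RuppertMatrix.lean`) on the box
`deg G, deg H ≤ deg φ − 1` is spanned by the `r` pairs `(φ/φᵢ · ∂_X φᵢ, φ/φᵢ · ∂_Y φᵢ)` — S. Gao,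
*Factoring multivariate polynomials via partial differential equations*, Math. Comp. 72 (2003)
801–822, Thm. 2.3 ("`dim_F G = r`, the number of absolutely irreducible factors"; Gao works in the
bidegree normalisation, we work in the total-degree normalisation of W. M. Ruppert, J. Number
Theory 77 (1999) 62–70, already fixed by the tree). The heart of Gao's proof (p. 805: the
residues `λᵢ` of `g/f` at the roots of `fᵢ` "are constants", being algebraic functions with
vanishing derivative) is proved here in the following derivation-theoretic form, which avoids
partial fractions:

* `Ruppert.exists_C_dvd_sub_of_tangent` — for `g ∈ F[X, Y]` irreducible (`F` algebraically
  closed, `char F = 0`), `δ = g_Y ∂_X − g_X ∂_Y` the derivation tangent to the curve `g = 0`, and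
  `u, v` with `g ∤ v`, `g ∣ δ(u) v − u δ(v)` (i.e. `u/v` is a `δ`-constant in the function field
  `F(C)` of the curve), there is `c ∈ F` with `g ∣ u − c v`.

Proof: `δ` induces an `F`-derivation `D` of `F(C) = Frac(F[X, Y]/(g))` (descent to the quotient,
tree `Derivation.quotientLift`; extension to fractions, tree `Derivation.fractionFieldExtend`),
non-zero since `g` does not divide both `g_X`, `g_Y` in characteristic zero; `F(C)` has
transcendence degree `≤ 1` (matroid exchange, tree `AlgebraicDependenceBookkeeping`), so over
`F(θ)`, `θ` any transcendental element, `F(C)` is algebraic and separable; a derivation killing a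
transcendental `θ` would kill `F(θ)` and then, by the separable minimal polynomials, everything —
so `D`-constants are algebraic over `F`, hence in `F`. Also recorded: `Ruppert.not_dvd_pderiv_or`.

No definitions, no named facts; helper lemmas are private.

## References

* S. Gao, Math. Comp. 72 (2003) 801–822, Thm. 2.3 and its proof. [`GaoPDE2003`]
* W. M. Ruppert, J. Number Theory 77 (1999) 62–70, §3. [`Ruppert1999`]
-/

noncomputable section

open MvPolynomial

namespace Literature.RingTheory.MvPolynomial

namespace Ruppert

open Literature.FieldTheory.TranscendenceDegree

variable {F : Type*} [Field F]

/-! ### Constants of a derivation on an extension of transcendence degree at most one -/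

/-- A derivation killing `θ` kills `F(θ)`. [folklore] -/
private theorem derivation_eq_zero_of_mem_adjoin_simple {L : Type*} [Field L] [Algebra F L]
    (D : Derivation F L L) {θ : L} (hθ : D θ = 0) {k : L}
    (hk : k ∈ IntermediateField.adjoin F {θ}) : D k = 0 := by
  rw [IntermediateField.mem_adjoin_simple_iff] at hk
  obtain ⟨r, s, rfl⟩ := hk
  rw [D.leibniz_div, D.map_aeval, D.map_aeval, hθ]
  simp

/-- **Constants of a non-zero derivation are algebraic** when every transcendental element is a
transcendence basis (characteristic zero): if `D ≠ 0` is an `F`-derivation of `L`, `L` is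
algebraic over `F[θ]` for every transcendental `θ`, and `D θ = 0`, then `θ` is algebraic over `F`.
(Otherwise `D` kills `F(θ)`, is an `F(θ)`-derivation, and kills every `w ∈ L` through its
separable minimal polynomial: `0 = D(μ(w)) = μ'(w) D(w)`.) [folklore] -/
private theorem isAlgebraic_of_derivation_eq_zero {L : Type*} [Field L] [Algebra F L] [CharZero F]
    (D : Derivation F L L) {w₀ : L} (hw₀ : D w₀ ≠ 0)
    (htr : ∀ θ : L, Transcendental F θ → ∀ w : L, IsAlgebraic (Algebra.adjoin F ({θ} : Set L)) w)
    {θ : L} (hθ : D θ = 0) : IsAlgebraic F θ := by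
  by_contra hθt
  set K₀ : IntermediateField F L := IntermediateField.adjoin F {θ} with hK₀
  have hkill : ∀ k : K₀, D (k : L) = 0 := fun k =>
    derivation_eq_zero_of_mem_adjoin_simple D hθ k.2
  -- `D` as a `K₀`-derivation
  let D' : Derivation K₀ L L :=
    { toFun := D
      map_add' := fun x y => D.map_add x y
      map_smul' := fun k x => by
        change D ((k : L) * x) = (k : L) * D x
        rw [D.leibniz, hkill k, smul_zero, add_zero, smul_eq_mul]
      map_one_eq_zero' := D.map_one_eq_zero
      leibniz' := fun a b => D.leibniz a b }
  have hD' : ∀ x, D' x = D x := fun x => rfl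
  -- `w₀` is algebraic over `K₀`, with separable minimal polynomial
  have halg : IsAlgebraic K₀ w₀ := by
    have hle : Algebra.adjoin F ({θ} : Set L) ≤ K₀.toSubalgebra :=
      IntermediateField.algebra_adjoin_le_adjoin F _
    exact (htr θ hθt w₀).tower_top_of_subalgebra_le hle
  haveI : CharZero K₀ := charZero_of_injective_ringHom (algebraMap F K₀).injective
  have hint : IsIntegral K₀ w₀ := halg.isIntegral
  have hsep : (minpoly K₀ w₀).Separable := (minpoly.irreducible hint).separable
  have h := D'.map_aeval (minpoly K₀ w₀) w₀
  rw [minpoly.aeval, map_zero] at h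
  have hne := hsep.aeval_derivative_ne_zero (minpoly.aeval K₀ w₀)
  rw [eq_comm, smul_eq_zero] at h
  rcases h with h | h
  · exact hne h
  · exact hw₀ (by rw [← hD']; exact h)

/-- **The function field of a plane curve has transcendence degree `≤ 1`.** If an `F`-algebra
map `π : F[X, Y] → L` to a field kills a non-zero `g` and every element of `L` is a quotient of
two images, then `L` is algebraic over `F[θ]` for EVERY transcendental `θ ∈ L` (one of
`π(X), π(Y)` is a transcendence basis; exchange). [folklore] -/
private theorem isAlgebraic_adjoin_of_transcendental {L : Type*} [Field L] [Algebra F L]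
    (π : MvPolynomial (Fin 2) F →ₐ[F] L) {g : MvPolynomial (Fin 2) F} (hg0 : g ≠ 0)
    (hπg : π g = 0)
    (hsurj : ∀ w : L, ∃ p q : MvPolynomial (Fin 2) F, π q ≠ 0 ∧ w = π p / π q)
    {θ : L} (hθ : Transcendental F θ) (w : L) :
    IsAlgebraic (Algebra.adjoin F ({θ} : Set L)) w := by
  classical
  set x : L := π (X 0) with hx
  set y : L := π (X 1) with hy
  have hπ : ∀ p, π p = MvPolynomial.aeval ![x, y] p := by
    intro p
    have h := MvPolynomial.aeval_unique π
    have hfun : (⇑π ∘ X : Fin 2 → L) = ![x, y] := by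
      funext i; fin_cases i <;> rfl
    rw [h, hfun]
  have hrel : MvPolynomial.aeval ![x, y] g = 0 := by rw [← hπ, hπg]
  -- one element `a` over which `x` and `y` are algebraic
  obtain ⟨a, hxa, hya⟩ : ∃ a : L, IsAlgebraic (Algebra.adjoin F ({a} : Set L)) x ∧
      IsAlgebraic (Algebra.adjoin F ({a} : Set L)) y := by
    by_cases hxt : Transcendental F x
    · exact ⟨x, isAlgebraic_adjoin_of_mem rfl,
        isAlgebraic_adjoin_singleton_of_aeval_eq_zero hg0 hrel hxt⟩
    · refine ⟨y, ?_, isAlgebraic_adjoin_of_mem rfl⟩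
      have hxF : IsAlgebraic F x := by
        unfold Transcendental at hxt; push Not at hxt; exact hxt
      exact hxF.extendScalars (algebraMap F (Algebra.adjoin F ({y} : Set L))).injective
  -- every image `π p` is algebraic over `F[a]`
  set S : Subalgebra (Algebra.adjoin F ({a} : Set L)) L :=
    Subalgebra.algebraicClosure (Algebra.adjoin F ({a} : Set L)) L with hS
  have hmemS : ∀ z : L, z ∈ S ↔ IsAlgebraic (Algebra.adjoin F ({a} : Set L)) z := fun z =>
    Subalgebra.mem_algebraicClosure _ _
  have hπS : ∀ p : MvPolynomial (Fin 2) F, π p ∈ S := by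
    intro p
    rw [hπ]
    induction p using MvPolynomial.induction_on with
    | C c =>
      rw [MvPolynomial.algHom_C, IsScalarTower.algebraMap_apply F (Algebra.adjoin F ({a} : Set L)) L]
      exact S.algebraMap_mem _
    | add p q hp hq => rw [map_add]; exact S.add_mem hp hq
    | mul_X p i hp =>
      rw [map_mul, MvPolynomial.aeval_X]
      refine S.mul_mem hp ?_
      rw [hmemS]
      fin_cases i
      · exact hxa
      · exact hya
  -- hence every element of `L` is
  have hall : ∀ z : L, IsAlgebraic (Algebra.adjoin F ({a} : Set L)) z := by
    intro z
    obtain ⟨p, q, -, rfl⟩ := hsurj z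
    rw [div_eq_mul_inv, ← hmemS]
    refine S.mul_mem (hπS p) ?_
    rw [hmemS, IsAlgebraic.inv_iff, ← hmemS]
    exact hπS q
  -- exchange
  exact isAlgebraic_adjoin_of_isAlgebraic_singleton (isAlgebraic_exchange (hall θ) hθ) (hall w)

/-! ### The tangent derivation on the function field of the curve -/

set_option maxHeartbeats 400000 in
/-- **The tangent derivation `δ = g_Y ∂_X − g_X ∂_Y` on the function field of `g = 0`**: with
`π : F[X, Y] → F[X, Y]/(g) → L = Frac(F[X, Y]/(g))`, there is an `F`-derivation `D` of `L` with
`D (π p) = π (δ p)` (`δ(g) = 0`, so `δ` preserves `(g)` and descends; then it extends to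
fractions). [folklore] -/
private theorem exists_derivation_functionField (g : MvPolynomial (Fin 2) F)
    [(Ideal.span ({g} : Set (MvPolynomial (Fin 2) F))).IsPrime] :
    ∃ D : Derivation F
        (FractionRing (MvPolynomial (Fin 2) F ⧸ Ideal.span ({g} : Set (MvPolynomial (Fin 2) F))))
        (FractionRing (MvPolynomial (Fin 2) F ⧸ Ideal.span ({g} : Set (MvPolynomial (Fin 2) F)))),
      ∀ p : MvPolynomial (Fin 2) F,
        D (algebraMap (MvPolynomial (Fin 2) F) _ p) =
          algebraMap (MvPolynomial (Fin 2) F) _ (pderiv 1 g * pderiv 0 p - pderiv 0 g * pderiv 1 p) := by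
  -- the derivation `δ` of `F[X, Y]`
  let δ : Derivation F (MvPolynomial (Fin 2) F) (MvPolynomial (Fin 2) F) :=
    pderiv 1 g • (pderiv 0 : Derivation F (MvPolynomial (Fin 2) F) (MvPolynomial (Fin 2) F)) -
      pderiv 0 g • (pderiv 1 : Derivation F (MvPolynomial (Fin 2) F) (MvPolynomial (Fin 2) F))
  have hδ : ∀ p, δ p = pderiv 1 g * pderiv 0 p - pderiv 0 g * pderiv 1 p := fun p => by
    simp [δ]
  have hδg : δ g = 0 := by rw [hδ]; ring
  have hπ' : ∀ p : MvPolynomial (Fin 2) F,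
      algebraMap (MvPolynomial (Fin 2) F)
          (FractionRing (MvPolynomial (Fin 2) F ⧸ Ideal.span ({g} : Set (MvPolynomial (Fin 2) F)))) p =
        algebraMap (MvPolynomial (Fin 2) F ⧸ Ideal.span ({g} : Set (MvPolynomial (Fin 2) F))) _
          (Ideal.Quotient.mk (Ideal.span ({g} : Set (MvPolynomial (Fin 2) F))) p) := fun p => by
    rw [IsScalarTower.algebraMap_apply (MvPolynomial (Fin 2) F)
      (MvPolynomial (Fin 2) F ⧸ Ideal.span ({g} : Set (MvPolynomial (Fin 2) F))),
      Ideal.Quotient.algebraMap_eq]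
  -- `p ↦ π (δ p)`, a derivation of `F[X, Y]` with values in the module `L`
  have hsmulPL : ∀ (p : MvPolynomial (Fin 2) F)
      (z : FractionRing (MvPolynomial (Fin 2) F ⧸ Ideal.span ({g} : Set (MvPolynomial (Fin 2) F)))),
      p • z = algebraMap _ _ p * z := fun p z => Algebra.smul_def p z
  let d : Derivation F (MvPolynomial (Fin 2) F)
      (FractionRing (MvPolynomial (Fin 2) F ⧸ Ideal.span ({g} : Set (MvPolynomial (Fin 2) F)))) :=
    { toFun := fun p => algebraMap _ _ (δ p)
      map_add' := fun p q => by
        show algebraMap _ _ (δ (p + q)) = _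
        rw [map_add, map_add]
      map_smul' := fun c p => by
        show algebraMap _ _ (δ (c • p)) = c • algebraMap _ _ (δ p)
        rw [Derivation.map_smul, Algebra.smul_def, Algebra.smul_def, map_mul,
          ← IsScalarTower.algebraMap_apply F (MvPolynomial (Fin 2) F)]
      map_one_eq_zero' := by
        show algebraMap _ _ (δ 1) = 0
        rw [Derivation.map_one_eq_zero, map_zero]
      leibniz' := fun a b => by
        show algebraMap _ _ (δ (a * b)) = a • algebraMap _ _ (δ b) + b • algebraMap _ _ (δ a)
        rw [Derivation.leibniz, map_add, smul_eq_mul, smul_eq_mul, map_mul, map_mul, hsmulPL,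
          hsmulPL] }
  have hd : ∀ p, d p = algebraMap _ _ (δ p) := fun p => rfl
  -- it kills `(g)`, so it descends to the coordinate ring
  have hdI : ∀ p ∈ Ideal.span ({g} : Set (MvPolynomial (Fin 2) F)), d p = 0 := by
    intro p hp
    obtain ⟨a, rfl⟩ := Ideal.mem_span_singleton'.mp hp
    rw [Derivation.leibniz, hd g, hδg, map_zero, smul_zero, zero_add, hsmulPL, hπ' g,
      Ideal.Quotient.eq_zero_iff_mem.mpr (Ideal.mem_span_singleton_self g), map_zero, zero_mul]
  let dQ : Derivation F (MvPolynomial (Fin 2) F ⧸ Ideal.span ({g} : Set (MvPolynomial (Fin 2) F)))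
      (FractionRing (MvPolynomial (Fin 2) F ⧸ Ideal.span ({g} : Set (MvPolynomial (Fin 2) F)))) :=
    Literature.AlgebraicGeometry.Resolution.Derivation.quotientLift _ d hdI
  have hdQ : ∀ p : MvPolynomial (Fin 2) F, dQ (Ideal.Quotient.mk _ p) = d p := fun p =>
    Literature.AlgebraicGeometry.Resolution.Derivation.quotientLift_mk _ d hdI p
  -- and extends to the field of fractions
  refine ⟨dQ.fractionFieldExtend
    (F := FractionRing (MvPolynomial (Fin 2) F ⧸ Ideal.span ({g} : Set (MvPolynomial (Fin 2) F))))
    (K := FractionRing (MvPolynomial (Fin 2) F ⧸ Ideal.span ({g} : Set (MvPolynomial (Fin 2) F)))),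
    fun p => ?_⟩
  rw [hπ' p, Derivation.fractionFieldExtend_algebraMap, hdQ, hd, hδ]

/-! ### Residue constancy -/

/-- A non-constant `g ∈ F[X, Y]`, `char F = 0`, does not divide both of its partial derivatives
(Ruppert: "if `∂g/∂x = ∂g/∂y = 0` then `g` is constant in characteristic `0`").
[cite: Ruppert1999, §3 (opening remark)] -/
theorem not_dvd_pderiv_or [CharZero F] {g : MvPolynomial (Fin 2) F} (hg : 0 < g.totalDegree) :
    ¬ g ∣ pderiv 0 g ∨ ¬ g ∣ pderiv 1 g := by
  by_contra h
  push Not at h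
  have h0 := pderiv_eq_zero_of_dvd hg 0 h.1
  have h1 := pderiv_eq_zero_of_dvd hg 1 h.2
  have hchar : ∀ a : ℕ, 0 < a → a ≤ g.totalDegree → (a : F) ≠ 0 := fun a ha _ => by
    exact_mod_cast ha.ne'
  rcases pderiv_ne_zero_of_totalDegree_pos hchar hg le_rfl with h | h
  · exact h h0
  · exact h h1

/-- An irreducible polynomial is non-constant. [folklore] -/
private theorem totalDegree_pos_of_irreducible {g : MvPolynomial (Fin 2) F} (hg : Irreducible g) :
    0 < g.totalDegree := by
  by_contra h0
  have h0' : g.totalDegree = 0 := by omega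
  by_cases hc : coeff 0 g = 0
  · apply hg.ne_zero
    rw [totalDegree_eq_zero_iff_eq_C] at h0'
    rw [h0', hc, C_0]
  · exact hg.not_isUnit (MvPolynomial.isUnit_iff_totalDegree_of_isReduced.mpr
      ⟨(Ne.isUnit hc), h0'⟩)

/-- **Residues are constant (Gao).** Let `F` be algebraically closed of characteristic zero,
`g ∈ F[X, Y]` irreducible, `δ = g_Y ∂_X − g_X ∂_Y` the derivation tangent to the curve `g = 0`,
and `u, v ∈ F[X, Y]` with `g ∤ v` and `g ∣ δ(u) v − u δ(v)` — i.e. `u/v` is a `δ`-constant in the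
function field of the curve. Then `u ≡ c · v (mod g)` for a constant `c ∈ F`. (Gao, proof of
Thm. 2.3: the residues `λᵢ = g(αᵢ)/f_x(αᵢ)` have zero derivative, hence are algebraic constants;
here `δ` induces a non-zero `F`-derivation of `F(C) = Frac(F[X, Y]/(g))`, a field of
transcendence degree one, whose constants are therefore algebraic over `F`, hence in `F`.)
[cite: GaoPDE2003, Thm. 2.3 (proof)] -/
theorem exists_C_dvd_sub_of_tangent [IsAlgClosed F] [CharZero F] {g : MvPolynomial (Fin 2) F}
    (hg : Irreducible g) {u v : MvPolynomial (Fin 2) F} (hv : ¬ g ∣ v)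
    (hkey : g ∣ (pderiv 1 g * pderiv 0 u - pderiv 0 g * pderiv 1 u) * v -
      u * (pderiv 1 g * pderiv 0 v - pderiv 0 g * pderiv 1 v)) :
    ∃ c : F, g ∣ u - C c * v := by
  classical
  haveI hI : (Ideal.span ({g} : Set (MvPolynomial (Fin 2) F))).IsPrime :=
    (Ideal.span_singleton_prime hg.ne_zero).mpr hg.prime
  obtain ⟨D, hD⟩ := exists_derivation_functionField g
  have hπ' : ∀ p : MvPolynomial (Fin 2) F,
      algebraMap (MvPolynomial (Fin 2) F)
          (FractionRing (MvPolynomial (Fin 2) F ⧸ Ideal.span ({g} : Set (MvPolynomial (Fin 2) F)))) p =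
        algebraMap (MvPolynomial (Fin 2) F ⧸ Ideal.span ({g} : Set (MvPolynomial (Fin 2) F))) _
          (Ideal.Quotient.mk (Ideal.span ({g} : Set (MvPolynomial (Fin 2) F))) p) := fun p => by
    rw [IsScalarTower.algebraMap_apply (MvPolynomial (Fin 2) F)
      (MvPolynomial (Fin 2) F ⧸ Ideal.span ({g} : Set (MvPolynomial (Fin 2) F))),
      Ideal.Quotient.algebraMap_eq]
  set π : MvPolynomial (Fin 2) F →ₐ[F]
      FractionRing (MvPolynomial (Fin 2) F ⧸ Ideal.span ({g} : Set (MvPolynomial (Fin 2) F))) :=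
    IsScalarTower.toAlgHom F (MvPolynomial (Fin 2) F) _ with hπdef
  have hπ : ∀ p, π p = algebraMap (MvPolynomial (Fin 2) F) _ p := fun p => rfl
  -- kernel of `π`
  have hker : ∀ p, π p = 0 ↔ g ∣ p := by
    intro p
    rw [hπ, hπ', map_eq_zero_iff _ (IsFractionRing.injective
      (MvPolynomial (Fin 2) F ⧸ Ideal.span ({g} : Set (MvPolynomial (Fin 2) F))) _),
      Ideal.Quotient.eq_zero_iff_mem, Ideal.mem_span_singleton]
  -- every element is a quotient of images
  have hsurj : ∀ w : FractionRing (MvPolynomial (Fin 2) F ⧸ Ideal.span ({g} : Set (MvPolynomial (Fin 2) F))),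
      ∃ p q : MvPolynomial (Fin 2) F, π q ≠ 0 ∧ w = π p / π q := by
    intro w
    obtain ⟨a, b, hb, rfl⟩ := IsFractionRing.div_surjective
      (A := MvPolynomial (Fin 2) F ⧸ Ideal.span ({g} : Set (MvPolynomial (Fin 2) F))) w
    obtain ⟨p, rfl⟩ := Ideal.Quotient.mk_surjective a
    obtain ⟨q, rfl⟩ := Ideal.Quotient.mk_surjective b
    refine ⟨p, q, ?_, by rw [hπ, hπ, hπ', hπ']⟩
    rw [hπ, hπ', map_ne_zero_iff _ (IsFractionRing.injective
      (MvPolynomial (Fin 2) F ⧸ Ideal.span ({g} : Set (MvPolynomial (Fin 2) F))) _)]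
    exact nonZeroDivisors.ne_zero hb
  have hDπ : ∀ p, D (π p) = π (pderiv 1 g * pderiv 0 p - pderiv 0 g * pderiv 1 p) := fun p => by
    rw [hπ, hπ, hD]
  -- `D ≠ 0`
  obtain ⟨w₀, hw₀⟩ : ∃ w₀, D w₀ ≠ 0 := by
    rcases not_dvd_pderiv_or (totalDegree_pos_of_irreducible hg) with h0 | h1
    · refine ⟨π (X 1), ?_⟩
      rw [hDπ, pderiv_X_of_ne (i := 0) (j := 1) (by decide), pderiv_X_self, mul_zero, mul_one,
        zero_sub, map_neg, neg_ne_zero]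
      exact fun h => h0 ((hker _).mp h)
    · refine ⟨π (X 0), ?_⟩
      rw [hDπ, pderiv_X_self, pderiv_X_of_ne (i := 1) (j := 0) (by decide), mul_zero, mul_one,
        sub_zero]
      exact fun h => h1 ((hker _).mp h)
  -- the `δ`-constant `θ = π u / π v`
  have hv' : π v ≠ 0 := fun h => hv ((hker v).mp h)
  have hθ : D (π u / π v) = 0 := by
    rw [D.leibniz_div, hDπ, hDπ, smul_eq_mul, smul_eq_mul, smul_eq_mul, ← map_mul, ← map_mul,
      ← map_sub]
    have h0 : π (v * (pderiv 1 g * pderiv 0 u - pderiv 0 g * pderiv 1 u) -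
        u * (pderiv 1 g * pderiv 0 v - pderiv 0 g * pderiv 1 v)) = 0 := by
      rw [hker]
      have : v * (pderiv 1 g * pderiv 0 u - pderiv 0 g * pderiv 1 u) -
          u * (pderiv 1 g * pderiv 0 v - pderiv 0 g * pderiv 1 v) =
          (pderiv 1 g * pderiv 0 u - pderiv 0 g * pderiv 1 u) * v -
            u * (pderiv 1 g * pderiv 0 v - pderiv 0 g * pderiv 1 v) := by ring
      rw [this]; exact hkey
    rw [h0, mul_zero]
  -- hence `θ` is algebraic, i.e. a scalar
  have htr := fun θ (hθt : Transcendental F θ) w =>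
    isAlgebraic_adjoin_of_transcendental π hg.ne_zero ((hker g).mpr dvd_rfl) hsurj hθt w
  have halg : IsAlgebraic F (π u / π v) := isAlgebraic_of_derivation_eq_zero D hw₀ htr hθ
  obtain ⟨c, hc⟩ := mem_range_algebraMap_of_isAlgebraic halg
  refine ⟨c, (hker _).mp ?_⟩
  have hπC : π (C c) = algebraMap F _ c := by
    rw [← MvPolynomial.algebraMap_eq]; exact π.commutes c
  rw [map_sub, map_mul, sub_eq_zero, hπC, hc, div_mul_cancel₀ _ hv']

end Ruppert

end Literature.RingTheory.MvPolynomial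

end
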